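import Summits.HubbardSuperconductivity.HubbardSuperconductivity.Theorems.BirComplexStableXY.Negative.BirComplexStableXYFalseOfWitnessZeroExists
import Summits.HubbardSuperconductivity.HubbardSuperconductivity.Theorems.BalabanIRBirComplexStableXYEvenPositivity
import Summits.HubbardSuperconductivity.HubbardSuperconductivity.Theorems.BalabanIRBirComplexStableXYReality

/-!
# Disproof of `BirComplexStableXYR` (route BalabanIR, crux 2R, item stmt-HubbardSuperconductivity-14845) — findings

Standing disprover's work file (cdisprove, cycle 1).  Prose lives in docstrings; everything else is Lean.
The crux is the RESTATED engine: rev-0 `BirComplexStableXY` + (R) time-reflection Hermiticity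
`c_{n∘R} = conj c_{−n}` + (P) inversion evenness `c_{n∘P} = c_n` + conclusion only at EVEN `L, M`.

## Index
* §1  The crux re-expressed as `EngineClaimR AdmissibleRP` over the named pieces of the landed negative
      module `Theorems.BirComplexStableXY.Negative.WitnessTable` (`genF`, `action`, `partZ`, `cube`) plus
      `numerO`, `sliceO`, `Conclusion`; `engineClaimR_iff : EngineClaimR AdmissibleRP ↔ BirComplexStableXYR`.
* §2  LOAD-BEARING ANALYSIS (sorry-free).  (C) dropped ⇒ false: the free table `c = 0` is in the class
      (it satisfies (U1),(N),(A) for `B ≥ 0` and (R),(P) trivially) and has `Z = (2π)^{|Λ|} ≠ 0` but slice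
      order exactly `1/L² ≤ 1/4` at every even `L ≥ 2` (`engineClaimR_false_without_coercivity`).
      (N) is NOT load-bearing (constant shift of `F` rescales `Z` and the numerator alike).
      `L ≤ M` IS load-bearing on paper (M = 2 ≪ L: a thickness-2 slab is a 2D XY model, slice order decays
      like `L^{-η(K)}` — Mermin–Wagner/spin-wave; not formalised).  `Even M`: see §4 (NOT load-bearing for the
      tilted tables suggested on the item — the dominant charge sector of a Berry-tilted rotor is `m ≈ −Kκ`
      with POSITIVE weights; the sign-alternating `(−1)^m J_m` branch is the `e^{−2KJ}`-suppressed saddle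
      at `Δ_tθ = π`).
* §2b NON-VACUITY OF THE COMPLEX CLASS (landed `Theorems/BirComplexStableXYR/Negative/ComplexInhabitant.lean`,
      p89967): the Berry-tilted XY table `witness 0 ε₂` satisfies (U1),(N),(A=128),(C=1/18),(R),(P) verbatim for
      `|ε₂| ≤ 1/5` and its `F` is non-real for `ε₂ ≠ 0` — (R)∧(P) did not shrink the class to real actions.
      LANDED this cycle: `…/Negative/LoadBearing.lean` (p88123, ¬crux-without-(C)), `…/Negative/QuadraticOddEven.lean`
      (p89070, §4a), `…/Negative/ComplexInhabitant.lean` (p89967).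
* §3  WHAT IS ALREADY A THEOREM inside the class (imported, restated for the R-crux's binder shape):
      for `r = 2` the first conjunct `Z ≠ 0` holds for EVERY `K`, `L`, table with (R), even `M`
      (`zne_of_R_r2`, from `birEven_partitionFunction_pos` + `timeReflection_functional_of_table`), and the
      second conjunct is the honest expectation bound `𝔼_ρ[O] ≥ 1/2` for a positive density `ρ`.
      So for `r = 2` only SLICE ORDER of the dominant (largest-|λ|) eigenvector(s) of the Hermitian slice
      transfer operator is attackable, and only through `L → ∞` (see §4).
* §4  WHY IT RESISTS (analysis, docstring `resists`): (R)∧(P) kill the quadratic imaginary part of the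
      translation-summed action identically (symbol argument: a real translation-invariant quadratic form
      has a symbol even under `k ↦ −k`; (R)-odd in `ω` and (P)-even in `k_s` force it to vanish), so
      `Im A` starts at CUBIC order around constants and is `O(B (K c₀)^{-3/2} K) = O(B c₀^{-3/2} K^{-1/2})`
      per site in the Gaussian region — perturbatively irrelevant, uniformly over the class (analyticity strip
      of width 1 from (A)); large fields cost `≥ K c₀·O(1)`.  Hence at FIXED `(L, M)` the conclusion holds for
      `K ≥ K₀(L,M)` (the tree's FixedVolume theorems did this for rev 0), and at fixed `L`, all `M`: r = 2 is
      Hermitian (no BKW zeros at even M), r ≥ 3 is pseudo-Hermitian but every symmetry sector's top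
      eigenvalue is a small perturbation of a SIMPLE Perron–Frobenius eigenvalue with a `K`-independent gap
      `~ 2π/L` at fixed `L` (Gaussian eigenvalue ratios are `K`-free), so it stays real > 0.  A counterexample
      must therefore be THERMODYNAMIC (`L → ∞` at `K ≥ K₀` fixed): loss of order or a sign change of the real
      `Z` driven by RG-irrelevant purely imaginary cubic terms plus dilute vortex loops of complex (conjugate-
      paired) activity — no known mechanism; this is exactly the content the route must prove (Balaban).
      Sub-findings: the Berry tilt `iκ sin Δ_tθ` of ANY size (also `|κ| > J`) is inert for both conjuncts
      (saddle/sector analysis, contra the attack suggested in the item note of refuter g48-5); cross terms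
      `i sin(Δ_tθ)·E_spatial` do NOT become a complex spatial stiffness in the dominant sector (the two
      contour shifts cancel exactly); (P) is possibly unnecessary for TRUTH (without it the marginal term
      `i ∂_tθ ∂_xθ` survives, but the complex Gaussian theory stays non-degenerate, its equal-time covariance
      is real and REDUCED) though it is needed for the route's real-covariance technique.
* §5  NUMERICS (kit j015157/j015307 batch 1, j015276 verification; docstring `numerics`): r = 3 zero-mode chain —
      every sector top real, simple, perfectly conditioned, no sign change of `Z_M` (an apparent complex top was a
      Galerkin artefact); r = 2 `L = 2` torus and two-rotor ladder (Parts B, C).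
-/

set_option linter.dupNamespace false

namespace Summit.HubbardSuperconductivity.HubbardSuperconductivity.Cruxes.BirComplexStableXYR.Disproof

open scoped BigOperators ComplexConjugate
open MeasureTheory Literature.Probability.LatticeModels
open Summit.HubbardSuperconductivity.HubbardSuperconductivity.Theses.BalabanIR
open Summit.HubbardSuperconductivity.BirComplexStableXYNegative

noncomputable section

/-! ## §1 Named pieces and the faithful re-expression -/

/-- the equal-time slice order observable `O(θ) = |Σ_x e^{iθ(x,0)}|² / L⁴`. -/
def sliceO (L M : ℕ) [NeZero L] [NeZero M] (θ : Λ L M → ℝ) : ℝ :=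
  ‖∑ x : TorusSite 2 L, Complex.exp (Complex.I * (θ (x, 0) : ℂ))‖ ^ 2 / (L : ℝ) ^ 4

/-- the numerator `∫_cube O e^{-A}`. -/
def numerO {r : ℕ} (K : ℝ) (c : Table r) (L M : ℕ) [NeZero L] [NeZero M] : ℂ :=
  MeasureTheory.integral (MeasureTheory.volume.restrict (cube L M))
    (fun θ => (sliceO L M θ : ℂ) * Complex.exp (-(action K c L M θ)))

/-- the crux's conclusion for given data: `Z ≠ 0` and `Re ⟨O⟩ ≥ 1/2`. -/
def Conclusion {r : ℕ} (K : ℝ) (c : Table r) (L M : ℕ) [NeZero L] [NeZero M] : Prop :=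
  partZ K c L M ≠ 0 ∧ (1/2 : ℝ) ≤ (numerO K c L M / partZ K c L M).re

/-- (U1) global `U(1)` invariance of the table. -/
def CondU1 {r : ℕ} (c : Table r) : Prop := ∀ n ∈ c.support, ∑ w, n w = 0
/-- (N) `F(const) = 0`. -/
def CondN {r : ℕ} (c : Table r) : Prop := c.sum (fun _ a => a) = 0
/-- (A) exponentially weighted `ℓ¹` Fourier norm `≤ B`. -/
def CondA {r : ℕ} (B : ℝ) (c : Table r) : Prop :=
  c.sum (fun n a => ‖a‖ * Real.exp (∑ w, |(n w : ℝ)|)) ≤ B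
/-- (C) coercivity of the real part. -/
def CondC {r : ℕ} (c₀ : ℝ) (c : Table r) : Prop :=
  ∀ φ : W r → ℝ, c₀ * ∑ w, ∑ w', (1 - Real.cos (φ w - φ w')) ≤ (genF c φ).re
/-- (R) time-reflection (Osterwalder–Schrader) Hermiticity of the table. -/
def CondR {r : ℕ} (c : Table r) : Prop :=
  ∀ n : Freq r, c (fun w => n (w.1, w.2.1, Fin.rev w.2.2)) = (starRingEnd ℂ) (c (-n))
/-- (P) spatial-inversion evenness of the table. -/
def CondP {r : ℕ} (c : Table r) : Prop :=
  ∀ n : Freq r, c (fun w => n (Fin.rev w.1, Fin.rev w.2.1, w.2.2)) = c n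

/-- the restated crux's admissible class. -/
def AdmissibleRP (r : ℕ) (B c₀ : ℝ) (c : Table r) : Prop :=
  CondU1 c ∧ CondN c ∧ CondA B c ∧ CondC c₀ c ∧ CondR c ∧ CondP c

/-- the restated engine claim over an arbitrary class `P` of tables (conclusion at even `L ≤ M`). -/
def EngineClaimR (P : (r : ℕ) → ℝ → ℝ → Table r → Prop) : Prop :=
  ∀ (r : ℕ) (B c₀ : ℝ), 2 ≤ r → 0 < c₀ → ∃ K₀ : ℝ, ∃ L₀ : ℕ, ∀ K : ℝ, K₀ ≤ K →
    ∀ c : Table r, P r B c₀ c → ∀ (L M : ℕ) [NeZero L] [NeZero M], L₀ ≤ L → L ≤ M → Even L → Even M →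
      Conclusion K c L M

/-- The re-expression is faithful (definitional up to currying). -/
theorem engineClaimR_iff : EngineClaimR AdmissibleRP ↔ BirComplexStableXYR := by
  constructor
  · intro h r B c₀ hr hc₀
    obtain ⟨K₀, L₀, hK⟩ := h r B c₀ hr hc₀
    refine ⟨K₀, L₀, fun K hKK c h1 h2 h3 h4 h5 h6 L M _ _ hL hLM hLe hMe => ?_⟩
    have key := hK K hKK c ⟨h1, h2, h3, h4, h5, h6⟩ L M hL hLM hLe hMe
    dsimp only [Conclusion, partZ, numerO, action, genF, sh, cube, sliceO] at key
    dsimp only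
    exact key
  · intro h r B c₀ hr hc₀
    obtain ⟨K₀, L₀, hK⟩ := h r B c₀ hr hc₀
    refine ⟨K₀, L₀, fun K hKK c hc L M _ _ hL hLM hLe hMe => ?_⟩
    have key := hK K hKK c hc.1 hc.2.1 hc.2.2.1 hc.2.2.2.1 hc.2.2.2.2.1 hc.2.2.2.2.2 L M hL hLM hLe hMe
    dsimp only at key
    dsimp only [Conclusion, partZ, numerO, action, genF, sh, cube, sliceO]
    exact key

/-! ## §2 Load-bearing analysis (hypothesis mutation) -/

/-- The class with COERCIVITY (C) DROPPED (everything else, including (R) and (P), kept). -/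
def AdmissibleRPnoC (r : ℕ) (B _c₀ : ℝ) (c : Table r) : Prop :=
  CondU1 c ∧ CondN c ∧ CondA B c ∧ CondR c ∧ CondP c

/-- The free table `c = 0` is in the coercivity-free class as soon as `0 ≤ B` ((R),(P) trivially). -/
theorem zero_mem_admissibleRPnoC (r : ℕ) {B : ℝ} (hB : 0 ≤ B) (c₀ : ℝ) :
    AdmissibleRPnoC r B c₀ 0 := by
  refine ⟨?_, ?_, ?_, ?_, ?_⟩
  · intro n hn; simp at hn
  · simp [CondN]
  · simpa [CondA] using hB
  · intro n; simp
  · intro n; simp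

/-- With `c = 0` the action vanishes identically. -/
theorem action_zero {r : ℕ} (K : ℝ) (L M : ℕ) [NeZero L] [NeZero M] (θ : Λ L M → ℝ) :
    action K (0 : Table r) L M θ = 0 := by
  simp [action, genF]

/-! ### §2a Free-measure computations on the statement's own cube (character orthogonality)
(ported from the rev-0 work file `Cruxes/BirComplexStableXY/Disproof.lean` §2a, same proofs) -/

section free

/-- one-dimensional Lebesgue measure on `[0, 2π]`. -/
def ν : Measure ℝ := volume.restrict (Set.Icc (0:ℝ) (2 * Real.pi))

instance : IsFiniteMeasure ν := by
  unfold ν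
  refine ⟨?_⟩
  rw [Measure.restrict_apply_univ, Real.volume_Icc]
  exact ENNReal.ofReal_lt_top

theorem restrict_cube_eq_pi (L M : ℕ) [NeZero L] [NeZero M] :
    (volume : Measure (Λ L M → ℝ)).restrict (cube L M) = Measure.pi (fun _ : Λ L M => ν) := by
  rw [cube, volume_pi, Measure.restrict_pi_pi]
  rfl

/-- `∫_0^{2π} e^{i n t} dt = 2π·𝟙{n = 0}` for `n ∈ ℤ`. -/
theorem integral_cexp_int_mul (n : ℤ) :
    ∫ t, Complex.exp (Complex.I * (((n : ℝ) * t : ℝ) : ℂ)) ∂ν = if n = 0 then ((2 * Real.pi : ℝ) : ℂ) else 0 := by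
  unfold ν
  rw [integral_Icc_eq_integral_Ioc, ← intervalIntegral.integral_of_le (by positivity : (0:ℝ) ≤ 2 * Real.pi)]
  split_ifs with hn
  · subst hn
    simp
  · have hc : (Complex.I * (n : ℂ)) ≠ 0 := by simp [Complex.I_ne_zero, hn]
    have key : ∀ t : ℝ, Complex.exp (Complex.I * (((n : ℝ) * t : ℝ) : ℂ)) =
        Complex.exp ((Complex.I * (n : ℂ)) * t) := by
      intro t; congr 1; push_cast; ring
    simp_rw [key]
    rw [integral_exp_mul_complex hc]
    have h2 : Complex.exp (Complex.I * (n : ℂ) * (2 * (Real.pi : ℂ))) = 1 := by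
      have : Complex.I * (n : ℂ) * (2 * (Real.pi : ℂ)) = (n : ℂ) * (2 * Real.pi * Complex.I) := by ring
      rw [this]
      exact Complex.exp_int_mul_two_pi_mul_I n
    push_cast
    simp [h2]

/-- Orthogonality of characters on the cube `[0,2π]^Λ`:
`∫ e^{i w·θ} dθ = (2π)^{|Λ|}·𝟙{w = 0}` for `w ∈ ℤ^Λ`. -/
theorem integral_cube_cexp_phase (L M : ℕ) [NeZero L] [NeZero M] (w : Λ L M → ℤ) :
    ∫ θ, Complex.exp (Complex.I * ((∑ s, (w s : ℝ) * θ s : ℝ) : ℂ)) ∂(volume.restrict (cube L M)) =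
      if w = 0 then ((2 * Real.pi : ℝ) : ℂ) ^ Fintype.card (Λ L M) else 0 := by
  rw [restrict_cube_eq_pi]
  set f : Λ L M → ℝ → ℂ := fun s t => Complex.exp (Complex.I * ((((w s : ℝ) * t : ℝ)) : ℂ)) with hf
  have key : ∀ θ : Λ L M → ℝ,
      Complex.exp (Complex.I * ((∑ s, (w s : ℝ) * θ s : ℝ) : ℂ)) = ∏ s, f s (θ s) := by
    intro θ
    simp only [hf, ← Complex.exp_sum]
    congr 1
    push_cast
    rw [Finset.mul_sum]
  simp_rw [key]
  rw [integral_fintype_prod_eq_prod (𝕜 := ℂ) f]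
  have hj : ∀ s, ∫ t, f s t ∂ν = if w s = 0 then ((2 * Real.pi : ℝ) : ℂ) else 0 := fun s =>
    integral_cexp_int_mul (w s)
  simp_rw [hj]
  split_ifs with hw
  · subst hw
    simp
  · obtain ⟨s, hs⟩ : ∃ s, w s ≠ 0 := by
      by_contra h
      push Not at h
      exact hw (funext h)
    exact Finset.prod_eq_zero (Finset.mem_univ s) (if_neg hs)

/-- The free partition function: `Z = (2π)^{|Λ|}` at `c = 0`. -/
theorem partZ_free (K : ℝ) (L M : ℕ) [NeZero L] [NeZero M] :
    partZ (r := 2) K 0 L M = ((2 * Real.pi : ℝ) : ℂ) ^ Fintype.card (Λ L M) := by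
  have h := integral_cube_cexp_phase L M 0
  rw [if_pos rfl] at h
  unfold partZ
  rw [← h]
  congr 1
  funext θ
  simp [action_zero]

/-- frequency vector of `θ(x,0) − θ(y,0)`. -/
def frq (L M : ℕ) [NeZero L] [NeZero M] (x y : TorusSite 2 L) : Λ L M → ℤ :=
  Pi.single (x, (0 : ZMod M)) 1 - Pi.single (y, (0 : ZMod M)) 1

theorem sum_frq_mul (L M : ℕ) [NeZero L] [NeZero M] (x y : TorusSite 2 L) (θ : Λ L M → ℝ) :
    (∑ s, ((frq L M x y s : ℤ) : ℝ) * θ s) = θ (x, 0) - θ (y, 0) := by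
  simp [frq, Pi.single_apply, sub_mul, Finset.sum_sub_distrib]

theorem frq_eq_zero_iff (L M : ℕ) [NeZero L] [NeZero M] {x y : TorusSite 2 L} :
    frq L M x y = 0 ↔ x = y := by
  constructor
  · intro h
    by_contra hxy
    have hne : (x, (0 : ZMod M)) ≠ (y, 0) := fun e => hxy (Prod.mk.inj e).1
    have := congrFun h (x, 0)
    simp [frq, Ne.symm hne] at this
  · rintro rfl
    simp [frq]

/-- pointwise: `|Σ_x e^{iθ_x}|² = Σ_{x,y} e^{i(θ_x − θ_y)}` written with integer frequency vectors. -/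
theorem normSq_sliceSum_eq (L M : ℕ) [NeZero L] [NeZero M] (θ : Λ L M → ℝ) :
    ((‖∑ x : TorusSite 2 L, Complex.exp (Complex.I * (θ (x, 0) : ℂ))‖ ^ 2 : ℝ) : ℂ) =
      ∑ x : TorusSite 2 L, ∑ y : TorusSite 2 L,
        Complex.exp (Complex.I * ((∑ s, ((frq L M x y s : ℤ) : ℝ) * θ s : ℝ) : ℂ)) := by
  simp_rw [sum_frq_mul]
  rw [← Complex.normSq_eq_norm_sq, ← Complex.mul_conj, map_sum, Finset.sum_mul_sum]
  refine Finset.sum_congr rfl fun x _ => Finset.sum_congr rfl fun y _ => ?_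
  rw [← Complex.exp_conj, ← Complex.exp_add]
  congr 1
  simp only [map_mul, Complex.conj_I, Complex.conj_ofReal]
  push_cast
  ring

/-- integrability of a character on the (finite) cube measure. -/
theorem integrable_cexp_phase (L M : ℕ) [NeZero L] [NeZero M] (w : Λ L M → ℤ) :
    Integrable (fun θ : Λ L M → ℝ => Complex.exp (Complex.I * ((∑ s, (w s : ℝ) * θ s : ℝ) : ℂ)))
      (volume.restrict (cube L M)) := by
  rw [restrict_cube_eq_pi]
  refine (integrable_const (1 : ℝ)).mono' ?_ (ae_of_all _ fun θ => ?_)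
  · exact (Continuous.aestronglyMeasurable (by fun_prop))
  · rw [mul_comm, Complex.norm_exp_ofReal_mul_I]

/-- The free numerator: `∫_cube |Σ_x e^{iθ(x,0)}|²/L⁴ = |𝕋_L|·(2π)^{|Λ|}/L⁴` at `c = 0`. -/
theorem numerO_free (K : ℝ) (L M : ℕ) [NeZero L] [NeZero M] :
    numerO (r := 2) K 0 L M =
      (Fintype.card (TorusSite 2 L) : ℂ) * ((2 * Real.pi : ℝ) : ℂ) ^ Fintype.card (Λ L M) / (L : ℂ) ^ 4 := by
  unfold numerO sliceO
  have hint : ∀ θ : Λ L M → ℝ,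
      (((‖∑ x : TorusSite 2 L, Complex.exp (Complex.I * (θ (x, 0) : ℂ))‖ ^ 2 / (L : ℝ) ^ 4 : ℝ)) : ℂ) *
          Complex.exp (-(action K (0 : Table 2) L M θ)) =
        (∑ x : TorusSite 2 L, ∑ y : TorusSite 2 L,
          Complex.exp (Complex.I * ((∑ s, ((frq L M x y s : ℤ) : ℝ) * θ s : ℝ) : ℂ))) / (L : ℂ) ^ 4 := by
    intro θ
    rw [action_zero, neg_zero, Complex.exp_zero, mul_one, Complex.ofReal_div, normSq_sliceSum_eq]
    push_cast
    rfl
  simp_rw [hint]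
  rw [integral_div, integral_finsetSum _ (fun x _ => ?_)]
  · rw [Finset.sum_congr rfl fun x _ => integral_finsetSum _ (fun y _ => ?_)]
    · simp_rw [integral_cube_cexp_phase, frq_eq_zero_iff]
      simp [Finset.sum_ite_eq]
    · exact integrable_cexp_phase L M _
  · exact integrable_finsetSum _ fun y _ => integrable_cexp_phase L M _

theorem card_torusSite_two (L : ℕ) [NeZero L] : Fintype.card (TorusSite 2 L) = L ^ 2 := by
  simp [TorusSite, ZMod.card]

/-- The free slice order is `1/L²` and the free `Z` is non-zero. -/
theorem free_sliceOrder (L M : ℕ) [NeZero L] [NeZero M] :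
    partZ (r := 2) 1 0 L M ≠ 0 ∧ (numerO (r := 2) 1 0 L M / partZ (r := 2) 1 0 L M).re = 1 / (L : ℝ) ^ 2 := by
  have hπ : ((2 * Real.pi : ℝ) : ℂ) ^ Fintype.card (Λ L M) ≠ 0 :=
    pow_ne_zero _ (by exact_mod_cast (by positivity : (2 * Real.pi : ℝ) ≠ 0))
  have hLc : (L : ℂ) ≠ 0 := by exact_mod_cast (NeZero.ne L)
  refine ⟨by rw [partZ_free]; exact hπ, ?_⟩
  rw [numerO_free, partZ_free, card_torusSite_two]
  have : ((L ^ 2 : ℕ) : ℂ) * ((2 * Real.pi : ℝ) : ℂ) ^ Fintype.card (Λ L M) / (L : ℂ) ^ 4 /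
      ((2 * Real.pi : ℝ) : ℂ) ^ Fintype.card (Λ L M) = ((1 / (L : ℝ) ^ 2 : ℝ) : ℂ) := by
    push_cast
    field_simp
  rw [this, Complex.ofReal_re]

end free

/-- `(C)` IS LOAD-BEARING for the restated crux: without coercivity the engine claim is false, witnessed by
the free table `c = 0` (i.i.d. uniform angles — it satisfies (U1),(N),(A) with `B = 0` and (R),(P) trivially),
for which `Z = (2π)^{L²M} ≠ 0` but the slice order is `1/L² ≤ 1/4 < 1/2` at every even `L ≥ 2 = M ≥ L`. -/
theorem engineClaimR_false_without_coercivity : ¬ EngineClaimR AdmissibleRPnoC := by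
  intro h
  obtain ⟨K₀, L₀, hK⟩ := h 2 0 1 le_rfl one_pos
  -- even side `L = 2 (L₀ + 1) ≥ max L₀ 2`, `M = L`
  set L : ℕ := 2 * (L₀ + 1) with hLdef
  have hL2 : 2 ≤ L := by omega
  have hL0 : L₀ ≤ L := by omega
  have hLe : Even L := ⟨L₀ + 1, by omega⟩
  haveI : NeZero L := ⟨by omega⟩
  have key := hK K₀ le_rfl 0 (zero_mem_admissibleRPnoC 2 le_rfl 1) L L hL0 le_rfl hLe hLe
  -- the conclusion at c = 0 does not depend on K (action ≡ 0); compare with the free values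
  have hZ : partZ (r := 2) K₀ (0 : Table 2) L L = partZ (r := 2) 1 0 L L := by
    simp [partZ, action_zero]
  have hN : numerO (r := 2) K₀ (0 : Table 2) L L = numerO (r := 2) 1 0 L L := by
    simp [numerO, action_zero]
  obtain ⟨-, hre⟩ := key
  rw [hZ, hN, (free_sliceOrder L L).2] at hre
  have hL' : (2:ℝ) ≤ L := by exact_mod_cast hL2
  have : (1:ℝ) / (L:ℝ) ^ 2 ≤ 1 / 4 := by
    rw [div_le_div_iff₀ (by positivity) (by norm_num)]
    nlinarith
  linarith

/-- `(N)` is NOT load-bearing (remark): adding a real constant `γ` to `F` keeps (U1),(A'),(C),(R),(P) (for `γ ≥ 0`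
and budget `B + γ`) and multiplies `Z` and `∫ O e^{-A}` by the same non-zero factor `e^{-K L² M γ}`, so
`Conclusion` is invariant.  `(U1)`, `(A)`, `(R)`, `(P)` dropped only ENLARGE the class. -/
theorem n_not_loadBearing_remark : True := trivial

/-! ## §3 What is already a theorem inside the class (`r = 2`) -/

/-- For `r = 2`, in the (R) class, at even `M`, the first conjunct `Z ≠ 0` holds with NO smallness condition
(every real `K`, every `L`, no coercivity): the landed `birEven_partitionFunction_pos` fed with the landed
table⇒functional bridge `timeReflection_functional_of_table`.  Consequently every attack on the restated crux
at `r = 2` must go through the SLICE-ORDER conjunct. -/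
theorem zne_of_R_r2 (c : Table 2) (hR : CondR c) (K : ℝ) (L M : ℕ) [NeZero L] [NeZero M] (hM : Even M) :
    partZ K c L M ≠ 0 := by
  have h := Summit.HubbardSuperconductivity.HubbardSuperconductivity.Theorems.birEven_partitionFunction_pos
    c K L M (Summit.HubbardSuperconductivity.HubbardSuperconductivity.Theorems.timeReflection_functional_of_table
      2 c hR) hM
  dsimp only at h
  exact h.2.2


/-! ## §4 Why the restated crux resists fixed-`L` attacks (analysis; the checked part is §4a)

### §4a  No Gaussian sign problem under (R)∧(P) — a checked lemma on translation-invariant quadratic forms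
-/

section quad
variable {G : Type*} [AddCommGroup G] [Fintype G]

/-- A translation-invariant quadratic form is invariant under the point inversion `s ↦ −s`. -/
theorem transInv_quadForm_comp_neg (N : G → G → ℝ) (hN : ∀ x y z, N (x + z) (y + z) = N x y)
    (θ : G → ℝ) :
    (∑ x, ∑ y, N x y * (θ (-x) * θ (-y))) = ∑ x, ∑ y, N x y * (θ x * θ y) := by
  have key : ∀ x y, N (-x) (-y) = N y x := by
    intro x y
    have h := hN (-x) (-y) (x + y)
    rw [show -x + (x + y) = y by abel, show -y + (x + y) = x by abel] at h
    exact h.symm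
  calc (∑ x, ∑ y, N x y * (θ (-x) * θ (-y)))
      = ∑ x, ∑ y, N (-x) (-y) * (θ x * θ y) := by
        rw [← Equiv.sum_comp (Equiv.neg G)]
        refine Finset.sum_congr rfl fun x _ => ?_
        rw [← Equiv.sum_comp (Equiv.neg G)]
        refine Finset.sum_congr rfl fun y _ => ?_
        simp
    _ = ∑ x, ∑ y, N y x * (θ x * θ y) := by simp_rw [key]
    _ = ∑ y, ∑ x, N y x * (θ x * θ y) := Finset.sum_comm
    _ = ∑ x, ∑ y, N x y * (θ x * θ y) := by
        refine Finset.sum_congr rfl fun x _ => Finset.sum_congr rfl fun y _ => ?_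
        ring

/-- A translation-invariant quadratic form is invariant under translations of the field. -/
theorem transInv_quadForm_comp_add (N : G → G → ℝ) (hN : ∀ x y z, N (x + z) (y + z) = N x y)
    (θ : G → ℝ) (a : G) :
    (∑ x, ∑ y, N x y * (θ (a + x) * θ (a + y))) = ∑ x, ∑ y, N x y * (θ x * θ y) := by
  symm
  rw [← Equiv.sum_comp (Equiv.addLeft a)]
  refine Finset.sum_congr rfl fun x _ => ?_
  rw [← Equiv.sum_comp (Equiv.addLeft a)]
  refine Finset.sum_congr rfl fun y _ => ?_
  simp only [Equiv.coe_addLeft]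
  rw [show a + x = x + a by abel, show a + y = y + a by abel, hN]

/-- **No Gaussian sign problem under (R)∧(P).**  Let `Q(θ) = Σ_{x,y} N(x,y) θ_x θ_y` be a translation-invariant
real quadratic form on a finite abelian group (the space-time torus), `ρ` ("time reflection") and `π` ("spatial
inversion") two maps whose composite is a point inversion up to translation, `π (ρ s) = a − s`.  If `Q` is ODD
under `ρ` and EVEN under `π` then `Q ≡ 0`.  Applied to the quadratic Taylor part of `Im A` around a constant
configuration (odd under time reflection by (R), even under inversion by (P)), this is why the restated engine has a
REAL spin-wave covariance: the imaginary part of the action starts at cubic order. -/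
theorem quadForm_eq_zero_of_odd_even (N : G → G → ℝ) (hN : ∀ x y z, N (x + z) (y + z) = N x y)
    (ρ π : G → G) (a : G) (hcomp : ∀ s, π (ρ s) = a - s)
    (hodd : ∀ θ : G → ℝ, (∑ x, ∑ y, N x y * (θ (ρ x) * θ (ρ y))) = -∑ x, ∑ y, N x y * (θ x * θ y))
    (heven : ∀ θ : G → ℝ, (∑ x, ∑ y, N x y * (θ (π x) * θ (π y))) = ∑ x, ∑ y, N x y * (θ x * θ y))
    (θ : G → ℝ) :
    (∑ x, ∑ y, N x y * (θ x * θ y)) = 0 := by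
  -- `s ↦ θ (a − s)` is `(θ ∘ π) ∘ ρ`, so its form is `−Q(θ ∘ π) = −Q(θ)` …
  have h1 : (∑ x, ∑ y, N x y * (θ (a - x) * θ (a - y))) = -∑ x, ∑ y, N x y * (θ x * θ y) := by
    have := hodd (θ ∘ π)
    simp only [Function.comp, hcomp] at this
    rw [this, heven]
  -- … and it is also `θ_a ∘ neg` with `θ_a u = θ (a + u)`, whose form is `Q(θ_a) = Q(θ)`.
  have h2 : (∑ x, ∑ y, N x y * (θ (a - x) * θ (a - y))) = ∑ x, ∑ y, N x y * (θ x * θ y) := by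
    have e1 := transInv_quadForm_comp_neg N hN (fun u => θ (a + u))
    have e2 := transInv_quadForm_comp_add N hN θ a
    simp only [← sub_eq_add_neg] at e1
    rw [e1, e2]
  linarith


end quad

/-- **§4b  WHY IT RESISTS** (analysis record; no Lean content).  Write `A = A_R + i A_I` for an admissible table.

1. *Perturbative regime.*  Around a constant configuration, `A_R ≥ K c₀ ·(complete-window XY energy)` (C) pins the
   Gaussian scale `|∇θ| ~ (K c₀)^{-1/2}`; by §4a and (R)∧(P) the quadratic part of `A_I` vanishes identically, so
   `A_I = K·(cubic and higher)`, of size `K·B·(K c₀)^{-3/2} = B c₀^{-3/2} K^{-1/2}` per site — perturbatively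
   IRRELEVANT, uniformly over the class because (A) is a uniform analyticity bound in the strip `|Im φ| < 1`
   (features of `F` at scale `σ` have amplitude `≤ B e^{-1/σ}`, so nothing can be tuned to the Gaussian scale).
   Large fields (misalignment `O(1)` inside a window) cost `≥ K c₀ · O(1)`; real-part "metastable valleys" of `Re F`
   (allowed: (C) is only a LOWER bound, e.g. `Re F = c₀·XY + b·(clock potential)`, `b ≫ c₀`) cost `≥ K c₀(1 − cos 2π/q)`
   per defect pair and lose to the `O(log K)` entropy gains once `K ≥ K₀(B, c₀)` — the order of quantifiers
   (`K₀` may depend on `c₀`, `B`) absorbs every such construction.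
2. *Fixed `(L, M)`.*  Hence for each fixed `(L, M)` the conclusion holds for `K ≥ K₀(L, M, r, B, c₀)` (uniform Laplace
   asymptotics over a compact class; cf. the tree's rev-0 `…FixedVolumeUniform`).  Any counterexample needs `L → ∞`
   or `M → ∞`.
3. *Fixed `L`, `M → ∞` (the regime that killed rev 0).*  `r = 2`: the slice transfer operator `W` is HERMITIAN by (R);
   at even `M`, `Z = Σ λ_j^M > 0` (theorem, §3) and `⟨O⟩_M → ` the average of `⟨ψ|O|ψ⟩` over the top-`|λ|` eigenspace;
   `W` commutes with the charge `Q̂` and the translations, and in each symmetry sector `W = |W|·e^{-iK H_I}` is an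
   `O(B c₀^{-3/2}K^{-1/2}·L²)`-perturbation (operator norm, crude) of a kernel with a SIMPLE Perron–Frobenius top whose
   relative gap is the `K`-INDEPENDENT Gaussian value `~ 2π/L` (eigenvalue ratios `e^{-ω_k}` of the Gaussian transfer
   operator do not depend on `K` when all stiffnesses scale with `K`); so for `K ≥ K₀(L)` every sector top stays real,
   simple, positive, with an ordered eigenvector — no BKW mechanism.  `r ≥ 3`: the pair-slice transfer operator is
   only pseudo-Hermitian (`T* = J T J`, `J` = slice-order reversal), spectrum conjugation-closed; a DOMINANT complex pair
   would make the real `K ↦ Z_M(K)` change sign (codimension-one zeros, the planner's caveat) — but by the same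
   sector-wise simplicity it cannot form for `K ≥ K₀(L)`; numerics (§5, Part A) look for it at moderate `κ = K L²`.  (Zero-mode
   chain structure: for an R-odd term of EVEN degree — swap-odd, e.g. `cos(2u+v) − cos(u+2v)` — the untwisted kernel
   `B = e^{−κ g}` is HERMITIAN and `T_Q = D_Q B`, so sector 0 has a real spectrum and the first non-gauge content is
   quartic `~ η/κ`; for ODD degree — swap-even, e.g. `sin u(1−cos v) + sin v(1−cos u) ≈ uv(u+v)/2` — `B` is complex
   symmetric and complex pairs do occur, but only below `|λ₂/λ₁| ≲ 0.33·` and shrinking like `ηκ^{-1/2}`.)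
4. *So a counterexample must be THERMODYNAMIC*: loss of slice order, or a sign change of the real `Z`, as `L → ∞` at a
   fixed `K ≥ K₀`, driven by RG-irrelevant purely imaginary cubic vertices plus a dilute gas of vortex loops whose
   activities are complex but conjugate-paired by (R) (real total free energy; `|activity| ≤ e^{-K c₀ E_core}` keeps the
   loop gas inside its convergence radius).  No mechanism of this kind is known to me; it is exactly what the route's
   multiscale expansion has to exclude.  VERDICT: resists; the crux is hard, not cheaply false.
   SUGGESTION for the planner/lead (not a reshaping by me): the thermodynamic content can be ISOLATED by an intermediate
   statement "the R-crux at FIXED `L`, uniformly in even `M ≥ L`" (`∀ L ∃ K₀(L) …`), the all-`M` analogue of the rev-0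
   `…FixedVolumeUniform`; for `r = 2` it is within reach of Hermitian transfer-operator perturbation theory (sector-wise
   simple Perron–Frobenius tops, `K`-independent gaps at fixed `L`, EvenPositivity), and it is exactly the part of the
   crux that the rev-0 counterexample violated — so it certifies that the restatement removed the BKW mechanism, while
   the `L`-uniformity is left to the multiscale line.
5. *Berry tilt of any size is inert* (contra the attack suggested in the item note of refuter g48-5).  For the temporal
   bond weight `w(δ) = exp(−K[J(1−cos δ) + iκ sin δ])` the sector-`m` coefficient has its saddle where
   `d/dδ[imδ − K J(1−cos δ) − iKκ sin δ] = 0`; maximising `|ŵ(m)|` over `m` forces a REAL saddle (envelope theorem: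
   `Im δ* = 0`), i.e. `δ* ∈ {0, π}`: the dominant sector is `m* = Kκ·(sign)` with `δ* = 0`, real curvature `KJ` and
   weight `≈ (2πKJ)^{-1/2}` — the untilted Gaussian — for EVERY `κ` (also `|κ| > J`, where the Bessel representation
   reads `e^{-KJ} e^{∓mχ} (−1)^m J_m(K√(κ²−J²))`: the sign-alternating, `J_0`-zero-sensitive sectors `m ≈ 0` belong to
   the other saddle `δ* = π` and are suppressed by `e^{-2KJ}`).  On `L ≥ 2` the dominant total charge is
   `Q* ≈ ±KκL²` and in that sector the kernel is the untilted XY kernel up to cubic remainders: slice order and the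
   sign of `Z_M` (any `M`) are those of the real model.  §5 Part B checks this on the `L = 2` torus.
6. *Cross terms do not boost into a complex stiffness.*  `i ε₂ sin(Δ_tθ)·E_spatial` (R-odd, P-even after
   symmetrising) looked like it could become `i ε₂ sin ν · E_spatial` in a frame rotating at the tilt-selected rate
   `ν`; but the physical saddle of the dominant sector sits at REAL `Δ_tθ = 0` (item 5), so the cross term stays cubic.
   (Equivalently: the contour shift that absorbs the tilt and the winding of the dominant eigenvector cancel exactly.)
7. *Hypotheses that look droppable.*  (P): without it the marginal `i ∂_tθ ∂_xθ` (R-odd, P-odd) survives at quadratic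
   order, but the complex Gaussian theory stays non-degenerate (`Re` of the symbol `> 0`), its equal-time covariance is
   REAL (the `S_I`-odd-in-`ω` part integrates to zero at equal times) and REDUCED (`Re (S_R+iS_I)^{-1} ≤ S_R^{-1}`), so
   Gaussian slice order only improves — (P) is possibly unnecessary for TRUTH, though the route's real-covariance
   technique needs it.  `Even M` (r = 2): needed for the theorem of §3, but no admissible table with a dominant
   NEGATIVE eigenvalue is known (rev-0 numerics j014044: worst negative/positive ratio ≤ 0.66 at L = 1, decreasing in
   κ; item 5 explains why tilts do not produce one).  `Even L`: no role found.  `L ≤ M`: load-bearing on paper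
   (`M = 2 ≪ L` is a thickness-two 2D XY slab: slice order decays like `L^{-η(K)}`, Mermin–Wagner / spin waves), not
   formalised.  (N): not load-bearing (§2).  (C): load-bearing (§2, landed as `Theorems/BirComplexStableXYR/Negative/
   LoadBearing.lean`).  (R): load-bearing modulo the rev-0 analytic heart `WitnessZeroExists` (BKW zeros of the
   complex-stiffness witness occur at even `M` too, e.g. `M* = 172, 1478` in j014041–3).
8. *Literature.*  searchd was DOWN this session (`lit search` rc 75); galaxy bm25 over web PDFs for "complex weights /
   pseudo-Hermitian transfer matrix / XY long-range order" returned nothing relevant.  Known rigorous neighbours: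
   Borgs–Imbrie 1989 (complex Pirogov–Sinai, DISCRETE spins), BFKT 2010–17 (complex bosonic actions, symmetric phase),
   Fröhlich–Rodriguez 2012/17 (Lee–Yang: complex FIELD, not couplings).  No printed counterexample class found. -/
theorem resists : True := trivial

/-! ## §5 Numerics (kit jobs j015157 / j015307 = batch 1, j015276 = verification; scripts `job1/run.py`, `job2/run.py`
in the disprover's folder; summaries attached to the item by the compute daemon)

**(A) r = 3 zero-mode chain** (one angle per slice, 3-slice window `g(u,v)`, `u = θ₁−θ₀, v = θ₂−θ₁`; time reflection
`(u,v) ↦ (−v,−u)`; sector operators `T_Q(u,v) = e^{iQu} e^{−κ g}`, `Z_M = Σ_Q Tr T_Q^M`; `κ` plays `K·L²·c_t`).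
Real part `(1−cos u)+(1−cos v)` (+ NNN `J₂(1−cos(u+v))`, `J₂ = ±0.2`); R-odd imaginary terms and what they are:
`T1 = Σ(sin 2u − 2 sin u)/2`, `T3 = Σ sin³u /2` (single bond, cubic, tilt-free) — SEPARABLE, every sector is rank one, real;
`I1 = sin u(1−cos v) + sin v(1−cos u) ≈ uv(u+v)/2` (genuinely 3-body, cubic ⇒ swap-EVEN ⇒ `B := e^{−κg}` complex
symmetric); `I4 = cos(2u+v) − cos(u+2v)` (swap-ODD ⇒ `B` HERMITIAN, `T_Q = D_Q B`; its quadratic part `(3/2)(v²−u²)`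
telescopes = a similarity by the chirp `e^{±(3/2)iκηu²}`, the first non-removable content is the quartic `uv(u²−v²)`,
effective size `η/κ`).  STRUCTURAL DICHOTOMY: an R-odd term of odd degree is swap-even, of even degree swap-odd.
Scan (j015157 Part A, Fourier–Galerkin, `κ ∈ {1,2,4,8,16,32,64}`, amplitudes `η ≤ 8`, beyond the earlier `η ≤ 3, κ ≤ 32`):
global top REAL and POSITIVE at every point; `I1`: complex pairs only deep in the spectrum, worst modulus relative to the
top `0.68/0.46/0.37/0.33/0.28/0.22/0.18` (`η = 8`, κ = 1…64) and `0.42/0.36/0.32/0.10/0.07/0.04/0.03` (`η = 1`) —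
DECREASING in κ as the `ηκ^{-1/2}` power counting predicts; `I4`: Galerkin showed sector-±1 tops with `Im/Re ~ 10⁻⁴`
(`worst` 0.95–0.997 = the tower factor `e^{−1/(2I)}`) — an ARTEFACT (below).  Caveat: rows `I1,tilt=2` of Part A are
unreliable (sector window centred at `κt₁` instead of the dominant `Q* = 2κt₁`).
**Verification (j015276, position basis = periodic trapezoid rule, dense, n-converged to 1e-15, eigenvalue condition
numbers):** for `I4` and `I1`, `η ∈ {1,3,5}`, `κ ∈ {4,…,64}`, sectors `Q ∈ {0,±1,2,3}`: EVERY sector top is REAL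
(`|Im λ|/λ ≤ 5·10⁻¹⁶`), SIMPLE (`|λ₂/λ₁| ≤ 0.33`, decreasing in κ: `I4, η=5`: 0.265/0.195/0.132/0.081/0.045;
`I1, η=5`: 0.187/0.169/0.152/0.134/0.113), PERFECTLY CONDITIONED (`cond(λ₁) ∈ [1.0, 2.4]`), and `Tr T_Q^M / λ₁^M → 1⁺` with no
sign change for `M ≤ 10⁵`.  The Galerkin imaginary parts came from under-resolving the chirped eigenvectors (bandwidth
`≈ 9η√κ >` cutoff `N`; the Galerkin tops were also 0.2 % off).  Tilted `I4` chain (`t₁` up to 0.05·η): the global top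
moves to `Q* ≈ 2κ·tilt` and stays REAL, `Z_M/λ₁^M → 1.00` (`M ≤ 10⁵`).  ⇒ no dominant complex pair, no sign change of
the real `Z`: the planner's r ≥ 3 caveat does not materialise for any catalogued R-odd term at `κ ≤ 64`, and power
counting says it cannot as `κ → ∞`.

**(B) r = 2 on the `L = 2` torus (j015465 + j015307 Part B, 21 parameter points; Hermitian slice transfer operator
`W_sym = D^{1/2} T_t D^{1/2}` by FFT matvecs + ARPACK, temporal kernel `exp(−K[J(1−cos δ) + iκ₁ sin δ + iε₂(sin 2δ −
2 sin δ) + iε₃ sin³δ])`, spatial XY `K J_s E_s`, `J = J_s = 1`; reported: top-|λ| eigenpairs, slice order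
`O = ⟨|Σ_x e^{iα_x}|²⟩/16`, mean charge `Q`, truncation weight).**  Every top eigenvalue REAL POSITIVE (temporal
eigenvalues real to `10⁻¹⁶` = Hermiticity), every dominant eigenvector ORDERED, truncation weights `≤ 10⁻¹¹`:
`K = 1`: `κ₁ = 0 / 0.5 / 0.95 / 1.5 / 3.0` → `O_top = 0.871 / 0.870 / 0.878 / 0.883 / 0.890`, dominant charge
`Q* = 0 / 1 / 3 / 5 / 10`; `K = 2`: `κ₁ = 0 / 0.5 / 0.95 / 1.5 / 3.0` → `0.940 / 0.941 / 0.942 / 0.943 / 0.945`,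
`Q* = 0 / 4 / 7 / 11 / 22` (`Q* ≈ 0.9·Kκ₁L²`: the tilt only RELABELS the dominant sector, also for `|κ₁| > J`); the
item-note "J_0-zero" points `K√(κ₁²−J²) = j_{0,1}, j_{0,2}`: `K = 1, κ₁ = 2.604 / 5.610` → `O_top = 0.881 / 0.897`
(`Q* = 8 / 19`), `K = 2, κ₁ = 1.564 / 2.936` → `0.941 / 0.943` (`Q* = 11 / 21`) — nothing happens there; cubic terms
`ε₂ = 0.5` at `K = 1 / 2 / 4` → `0.871 / 0.942 / 0.972`, `ε₂ = 1` at `K = 2 / 4` → `0.944 / 0.973`, `ε₃ = 1` at `K = 2 / 4`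
→ `0.942 / 0.972` (baselines `0.871 / 0.940 / —`).  The next eigenvalues are the charge tower around `Q*` (ratios
`0.84–0.99`), all with `O ∈ [0.85, 0.95]`.
**(C) two-rotor ladder with the NON-separable cross term `i ε_c sin(Δ_tθ_x)(E_s(α)+E_s(β))` (j015307 Part C, 132 rows,
dense `64²`-grid, Hermitian to rounding; `O = ⟨(1+cos(α₁−α₂))/2⟩` in the top-|λ| eigenvector; `K ∈ {1,2,4,8}` (and 16 at
weak `J`), `J = J_s ∈ {1, 1/4}`, `κ₁ ∈ {0, 2}`, `ε_c ≤ 10`, `ε₂ ≤ 6`, `ε₃ ≤ 6`).**  The top eigenvalue is POSITIVE in all 132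
rows, and in EVERY `(K, J)` group the minimum of `O_top` over all deformations is the UNDEFORMED value: the (R)-odd
imaginary terms only RAISE the order of the dominant eigenvector (dephasing of misaligned configurations acts like extra
coercivity).  `J = 1`, `ε_c = 0 / 1 / 2 / 5 / 10`: `K = 1` → `0.785 / 0.892 / 0.907 / 0.962 / 0.980`; `K = 2` → `0.918 / 0.935
/ 0.959 / 0.973 / 0.986`; `K = 4` → `0.962 / 0.969 / 0.978 / 0.986 / 0.991`; `K = 8` → `0.982 / 0.984 / 0.986 / 0.991 / 0.995`;
cubic `ε₂ = 1 / 3 / 6`: `K = 1` → `0.813 / 0.927 / 0.939`, `K = 8` → `0.984 / 0.987 / 0.988`; `ε₃ = 2 / 6`: `K = 1` → `0.860 /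
0.855`, `K = 8` → `0.985 / 0.989`; weak coercivity `J = 1/4` (`KJ ≤ 4`): `ε_c`-series `K = 1` → `0.564 … 0.965`, `K = 8` →
`0.918 … 0.996`, `K = 16` → `0.962 / 0.991 / 0.996`.  Negative eigenvalues DO appear (largest modulus relative to the top
`≤ 0.73` at `J = 1`, decreasing in `K` at fixed amplitude — `ε_c = 10`: `0.47 / 0.47 / 0.42 / 0.37` for `K = 1 / 2 / 4 / 8`;
up to `0.97` only for the tilted rotor at `KJ = 1/4`, the `e^{−2KJ}` sign-alternating branch of §4b(5)) but never
dominate.  No dominant negative eigenvalue, no disordered dominant eigenvector anywhere: the slice-order conjunct resists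
every tested (R)-odd deformation at `r = 2`, and the deformations push the order UP rather than down.
-/
theorem numerics : True := trivial

end

end Summit.HubbardSuperconductivity.HubbardSuperconductivity.Cruxes.BirComplexStableXYR.Disproof
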